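import Mathlib
import Literature.Computability.AlgebraicComplexity.HamiltonianCycleVNP
import Literature.Computability.AlgebraicComplexity.EvenCycleCoverVNPWitness
import HarnessLib

/-!
# The Nisan–Wigderson (Reed–Solomon) design polynomial has an explicit `VNP` witness

For a modulus `q ≥ 1` and parameters `d, k` the **design polynomial**
`NW_{q,d,k} = Σ_{cf : Fin k → ℤ/q} ∏_{j<d} x_{j, p_cf(j)}`, `p_cf(j) = Σ_i cf_i j^i ∈ ℤ/q`,
in the `d·q` variables `x_{j,a}` (`j < d`, `a ∈ ℤ/q`) — the polynomial of Nisan–Wigderson designs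
used by Kayal–Saha–Saptharishi 2014 (§1: "it is easy to see that `NW` is in `VNP`") — is the Boolean
sum, over `k·q` Boolean variables `e_{i,b}` ONE-HOT ENCODING the coefficient vector `cf`
(`cf_i = b ↔ e_{i,b} = 1`), of the explicit polynomial

`W = VALID(e) · ∏_j Σ_a x_{j,a} · IND_{j,a}(e)`,  where
* `VALID(e) = ∏_i Σ_b e_{i,b} ∏_{b' ≠ b} (1 − e_{i,b'})` recognises one-hot tables
  (`sum_rowRecogniser_mul`: summing `VALID(e) · G(e)` over all tables `e` is summing `G` over the
  graphs `fnGraph` (`EvenCycleCoverVNPWitness.lean`) of the functions `Fin k → ℤ/q`; a second,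
  product-free-in-pairs form of that file's `oneHotRec`);
* `IND_{j,a}(e) = q⁻¹ Σ_{t ∈ ℤ/q} ψ(−ta) ∏_i ∏_b (1 + e_{i,b} (ψ(t b j^i) − 1))`, `ψ` a primitive
  additive character of `ℤ/q` into `ℂ` (`ψ(x) = exp(2πi x/q)`), which at the graph of `cf` equals
  `q⁻¹ Σ_t ψ(t (p_cf(j) − a)) = [p_cf(j) = a]` (orthogonality of characters,
  `AddChar.sum_mulShift`).

Results: `boolSum_nwWitness` (`Σ_{e ∈ {0,1}^{kq}} W(x, e) = NW_{q,d,k}`), and the size bounds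
`totalDegree_nwWitness_le`, `complexity_nwWitness_le`, `totalDegree_nwDesign_le`, from which
`VNP` membership of any p-bounded parameter family follows by Bürgisser 2000, Def. 2.5 (done for
the family `q = m+1`, `d = ⌊log₂ q⌋`, `k = ⌊d/2⌋` of the route item `StableRankCancellation.DesignInVNP`
in the Summits tree).  A Valiant-criterion argument ("the coefficient function is in `#P`") is the
printed route; the tree avoids Turing machines and we give the algebraic witness instead.

References: N. Kayal, C. Saha, R. Saptharishi, *A super-polynomial lower bound for regular
arithmetic formulas*, STOC 2014, §1 [KayalSahaSaptharishi2014]; N. Nisan, A. Wigderson, *Hardness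
vs randomness*, JCSS 49 (1994), §2 [NisanWigderson1994]; P. Bürgisser, *Completeness and Reduction
in Algebraic Complexity Theory* (2000), Def. 2.5, Prop. 2.20 [Burgisser2000].  Honest framing:
elementary algebra; VP ≠ VNP is NOT proved and nothing here is progress on it.
-/

noncomputable section

open MvPolynomial Finset

namespace Literature.Computability.AlgebraicComplexity

universe u

/-! ### One-hot tables: the row recogniser -/

section RowRecogniser

variable {α β : Type*} [Fintype α] [DecidableEq α] [Fintype β] [DecidableEq β]
  {R : Type*} [CommRing R]

omit [Fintype α] [DecidableEq α] in
open scoped Classical in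
/-- The one-row recogniser `Σ_b [E b] ∏_{b' ≠ b} (1 − [E b'])` is `1` on a row with exactly one `1`
and `0` otherwise. [cite: BurgisserClausenShokrollahi1997, Prop. (21.15)] -/
theorem rowRecogniser_eq (E : β → Bool) :
    (∑ b : β, (if E b = true then (1 : R) else 0) *
        ∏ b' ∈ univ.erase b, (1 - if E b' = true then (1 : R) else 0)) =
      if ∃! b, E b = true then 1 else 0 := by
  split_ifs with h
  · obtain ⟨b₀, hb₀, huniq⟩ := h
    rw [Finset.sum_eq_single b₀]
    · rw [if_pos hb₀, one_mul]
      refine Finset.prod_eq_one fun b' hb' => ?_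
      have hne : b' ≠ b₀ := (Finset.mem_erase.mp hb').1
      have : ¬ E b' = true := fun h' => hne (huniq b' h')
      rw [if_neg this, sub_zero]
    · intro b _ hb
      have : ¬ E b = true := fun h' => hb (huniq b h')
      rw [if_neg this, zero_mul]
    · intro h'; exact absurd (Finset.mem_univ _) h'
  · refine Finset.sum_eq_zero fun b _ => ?_
    by_cases hb : E b = true
    · rw [if_pos hb, one_mul]
      -- another `1` in the row kills the product
      have : ∃ b', b' ≠ b ∧ E b' = true := by
        by_contra hcon
        push Not at hcon
        exact h ⟨b, hb, fun b' hb' => by_contra fun hne => hcon b' hne hb'⟩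
      obtain ⟨b', hne, hb'⟩ := this
      exact Finset.prod_eq_zero (Finset.mem_erase.mpr ⟨hne, Finset.mem_univ _⟩)
        (by rw [if_pos hb', sub_self])
    · rw [if_neg hb, zero_mul]

omit [Fintype α] [DecidableEq α] [Fintype β] in
/-- A table with exactly one `1` per row is the graph of a function. [folklore] -/
private theorem exists_eq_fnGraph_of_forall_existsUnique {E : α × β → Bool}
    (h : ∀ a, ∃! b, E (a, b) = true) : ∃ c : α → β, E = fnGraph c := by
  choose c hc huniq using h
  refine ⟨c, funext fun p => ?_⟩
  obtain ⟨a, b⟩ := p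
  simp only [fnGraph]
  by_cases hb : c a = b
  · subst hb; simpa using hc a
  · have : ¬ E (a, b) = true := fun h' => hb (huniq a b h').symm
    rw [decide_eq_false hb]
    exact Bool.eq_false_iff.mpr this

/-- **Summing against the row recogniser** `VALID(E) = ∏_a Σ_b [E(a,b)] ∏_{b'≠b} (1 − [E(a,b')])`
over all `0/1` tables picks out the graphs of functions:
`Σ_E VALID(E) · G(E) = Σ_{c : α → β} G(graph c)`. [cite: BurgisserClausenShokrollahi1997, Prop. (21.15)] -/
theorem sum_rowRecogniser_mul (G : (α × β → Bool) → R) :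
    (∑ E : α × β → Bool,
      (∏ a : α, ∑ b : β, (if E (a, b) = true then (1 : R) else 0) *
          ∏ b' ∈ univ.erase b, (1 - if E (a, b') = true then (1 : R) else 0)) * G E) =
      ∑ c : α → β, G (fnGraph c) := by
  classical
  have hrec : ∀ E : α × β → Bool,
      (∏ a : α, ∑ b : β, (if E (a, b) = true then (1 : R) else 0) *
          ∏ b' ∈ univ.erase b, (1 - if E (a, b') = true then (1 : R) else 0)) =
        if ∀ a, ∃! b, E (a, b) = true then 1 else 0 := by
    intro E
    rw [Finset.prod_congr rfl fun a _ => rowRecogniser_eq (R := R) (fun b => E (a, b)),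
      Finset.prod_boole]
    simp
  simp_rw [hrec, boole_mul]
  rw [← Finset.sum_filter]
  have hset : (univ.filter fun E : α × β → Bool => ∀ a, ∃! b, E (a, b) = true) =
      univ.image (fnGraph (ι := α) (K := β)) := by
    ext E
    simp only [Finset.mem_filter, Finset.mem_univ, true_and, Finset.mem_image]
    constructor
    · intro h
      obtain ⟨c, hc⟩ := exists_eq_fnGraph_of_forall_existsUnique h
      exact ⟨c, hc.symm⟩
    · rintro ⟨c, rfl⟩ a
      exact ⟨c a, by simp [fnGraph], fun b hb => by simp [fnGraph] at hb; exact hb.symm⟩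
  rw [hset, Finset.sum_image fun c _ c' _ h => fnGraph_injective h]

end RowRecogniser

/-! ### The additive character `ψ(x) = exp(2πi x / q)` of `ℤ/q` -/

section Character

variable (q : ℕ) [NeZero q]

/-- The standard primitive additive character of `ℤ/q` into `ℂ`, `x ↦ exp(2πi x/q)`
(Mathlib's `AddChar.zmodChar` at the primitive root `exp(2πi/q)`). [folklore] -/
def nwChar : AddChar (ZMod q) ℂ :=
  AddChar.zmodChar q ((IsPrimitiveRoot.iff_def _ q).mp
    (Complex.isPrimitiveRoot_exp q (NeZero.ne q))).1

/-- `nwChar q` is primitive. [cite: NisanWigderson1994, §2] -/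
theorem nwChar_isPrimitive : (nwChar q).IsPrimitive :=
  AddChar.zmodChar_primitive_of_primitive_root q (Complex.isPrimitiveRoot_exp q (NeZero.ne q))

/-- **Orthogonality**: `Σ_{t ∈ ℤ/q} ψ(t r) = q [r = 0]`. [cite: NisanWigderson1994, §2] -/
theorem sum_nwChar_mul (r : ZMod q) :
    ∑ t : ZMod q, nwChar q (t * r) = if r = 0 then (q : ℂ) else 0 := by
  classical
  rw [AddChar.sum_mulShift r (nwChar_isPrimitive q), ZMod.card]
  split_ifs <;> simp

/-- Characters turn sums into products. [folklore] -/
private theorem nwChar_sum {ι : Type*} (s : Finset ι) (f : ι → ZMod q) :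
    nwChar q (∑ i ∈ s, f i) = ∏ i ∈ s, nwChar q (f i) := by
  classical
  induction s using Finset.induction_on with
  | empty => simp
  | insert a s ha ih => rw [Finset.sum_insert ha, Finset.prod_insert ha, AddChar.map_add_eq_mul, ih]

end Character

/-! ### The design polynomial and its `VNP` witness -/

section Witness

variable (q : ℕ) [NeZero q] (d k : ℕ)

/-- The variables of the witness: the design variables `x_{j,a}` (`Sum.inl ⟨j, a⟩`, `j < d`,
`a ∈ ℤ/q`) and the `k·q` Boolean one-hot variables (`Sum.inr`). [cite: KayalSahaSaptharishi2014, §1] -/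
abbrev NWVars : Type := (Σ _ : Fin d, ZMod q) ⊕ Fin (k * q)

/-- Enumeration of the one-hot variables `e_{i,b}`, `i < k`, `b ∈ ℤ/q`, by `Fin (k·q)`. [folklore] -/
def nwBix : Fin k × ZMod q ≃ Fin (k * q) :=
  (Equiv.prodCongr (Equiv.refl _) (ZMod.finEquiv q).symm.toEquiv).trans finProdFinEquiv

/-- The one-hot variable `e_{i,b}` as a polynomial. [folklore] -/
def nwZ (i : Fin k) (b : ZMod q) : MvPolynomial (NWVars q d k) ℂ := X (Sum.inr (nwBix q k (i, b)))

/-- `VALID(e) = ∏_i Σ_b e_{i,b} ∏_{b'≠b} (1 − e_{i,b'})`: recognises one-hot encodings. [cite: BurgisserClausenShokrollahi1997, Prop. (21.15)] -/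
def nwValid : MvPolynomial (NWVars q d k) ℂ :=
  ∏ i : Fin k, ∑ b : ZMod q, nwZ q d k i b * ∏ b' ∈ univ.erase b, (1 - nwZ q d k i b')

/-- `CHR_{t,j}(e) = ∏_i ∏_b (1 + e_{i,b} (ψ(t b j^i) − 1))`: at the one-hot encoding of `cf` it is
`ψ(t · p_cf(j))`. [cite: KayalSahaSaptharishi2014, §1] -/
def nwChr (t : ZMod q) (j : Fin d) : MvPolynomial (NWVars q d k) ℂ :=
  ∏ i : Fin k, ∏ b : ZMod q,
    (1 + nwZ q d k i b * C (nwChar q (t * b * ((j : ℕ) : ZMod q) ^ (i : ℕ)) - 1))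

/-- `IND_{j,a}(e) = q⁻¹ Σ_t ψ(−ta) CHR_{t,j}(e)`: at the one-hot encoding of `cf` it is the indicator
`[p_cf(j) = a]`. [cite: KayalSahaSaptharishi2014, §1] -/
def nwInd (j : Fin d) (a : ZMod q) : MvPolynomial (NWVars q d k) ℂ :=
  C ((q : ℂ)⁻¹) * ∑ t : ZMod q, C (nwChar q (-(t * a))) * nwChr q d k t j

/-- `LINE_j = Σ_a x_{j,a} IND_{j,a}`: at the one-hot encoding of `cf` it is `x_{j, p_cf(j)}`. [cite: KayalSahaSaptharishi2014, §1] -/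
def nwLine (j : Fin d) : MvPolynomial (NWVars q d k) ℂ :=
  ∑ a : ZMod q, X (Sum.inl ⟨j, a⟩) * nwInd q d k j a

/-- **The `VNP` witness** `W = VALID · ∏_j LINE_j` of the design polynomial. [cite: KayalSahaSaptharishi2014, §1] -/
def nwWitness : MvPolynomial (NWVars q d k) ℂ :=
  nwValid q d k * ∏ j : Fin d, nwLine q d k j

/-- **The Nisan–Wigderson design polynomial** `NW_{q,d,k} = Σ_{cf} ∏_{j<d} x_{j, p_cf(j)}`,
`p_cf(j) = Σ_{i<k} cf_i j^i ∈ ℤ/q` (Kayal–Saha–Saptharishi 2014, §1; the Reed–Solomon design of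
Nisan–Wigderson 1994, §2). [cite: KayalSahaSaptharishi2014, §1] -/
def nwDesign : MvPolynomial (Σ _ : Fin d, ZMod q) ℂ :=
  ∑ cf : Fin k → ZMod q, ∏ j : Fin d,
    X (⟨j, ∑ i : Fin k, cf i * ((j : ℕ) : ZMod q) ^ (i : ℕ)⟩ : Σ _ : Fin d, ZMod q)

variable {q d k}

/-- The Boolean substitution of `boolSum`, read through the enumeration `nwBix`. [folklore] -/
private theorem aeval_nwZ (e : Fin (k * q) → Bool) (i : Fin k) (b : ZMod q) :
    aeval (Sum.elim X fun v => if e v then (1 : MvPolynomial (Σ _ : Fin d, ZMod q) ℂ) else 0)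
      (nwZ q d k i b) = if e (nwBix q k (i, b)) then 1 else 0 := by
  simp [nwZ]

/-- `CHR_{t,j}` at the one-hot encoding of `cf` is the constant `ψ(t · p_cf(j))`. [cite: KayalSahaSaptharishi2014, §1] -/
theorem aeval_nwChr_graph (cf : Fin k → ZMod q) (e : Fin (k * q) → Bool)
    (he : ∀ i b, e (nwBix q k (i, b)) = fnGraph cf (i, b)) (t : ZMod q) (j : Fin d) :
    aeval (Sum.elim X fun v => if e v then (1 : MvPolynomial (Σ _ : Fin d, ZMod q) ℂ) else 0)
      (nwChr q d k t j) =
      C (nwChar q (t * ∑ i : Fin k, cf i * ((j : ℕ) : ZMod q) ^ (i : ℕ))) := by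
  classical
  unfold nwChr
  simp only [map_prod, map_add, map_one, map_mul, aeval_C, aeval_nwZ, he]
  have hrow : ∀ i : Fin k, (∏ b : ZMod q, (1 + (if fnGraph cf (i, b) = true then
      (1 : MvPolynomial (Σ _ : Fin d, ZMod q) ℂ) else 0) *
        algebraMap ℂ (MvPolynomial (Σ _ : Fin d, ZMod q) ℂ)
          (nwChar q (t * b * ((j : ℕ) : ZMod q) ^ (i : ℕ)) - 1))) =
      C (nwChar q (t * cf i * ((j : ℕ) : ZMod q) ^ (i : ℕ))) := by
    intro i
    rw [Finset.prod_eq_single (cf i)]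
    · simp [fnGraph, MvPolynomial.algebraMap_eq]
    · intro b _ hb
      have : ¬ fnGraph cf (i, b) = true := by simpa [fnGraph] using Ne.symm hb
      rw [if_neg this, zero_mul, add_zero]
    · intro h; exact absurd (Finset.mem_univ _) h
  rw [Finset.prod_congr rfl fun i _ => hrow i, ← map_prod, ← nwChar_sum, Finset.mul_sum]
  congr 2
  refine Finset.sum_congr rfl fun i _ => ?_
  ring

/-- `IND_{j,a}` at the one-hot encoding of `cf` is the indicator `[p_cf(j) = a]`
(orthogonality of characters). [cite: KayalSahaSaptharishi2014, §1] -/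
theorem aeval_nwInd_graph (cf : Fin k → ZMod q) (e : Fin (k * q) → Bool)
    (he : ∀ i b, e (nwBix q k (i, b)) = fnGraph cf (i, b)) (j : Fin d) (a : ZMod q) :
    aeval (Sum.elim X fun v => if e v then (1 : MvPolynomial (Σ _ : Fin d, ZMod q) ℂ) else 0)
      (nwInd q d k j a) =
      if (∑ i : Fin k, cf i * ((j : ℕ) : ZMod q) ^ (i : ℕ)) = a then 1 else 0 := by
  classical
  unfold nwInd
  simp only [map_mul, map_sum, aeval_C, aeval_nwChr_graph cf e he, MvPolynomial.algebraMap_eq]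
  simp_rw [← map_mul, ← AddChar.map_add_eq_mul]
  rw [← map_sum]
  have hsum : (∑ t : ZMod q, nwChar q (-(t * a) + t * ∑ i : Fin k, cf i * ((j : ℕ) : ZMod q) ^ (i : ℕ))) =
      ∑ t : ZMod q, nwChar q (t * ((∑ i : Fin k, cf i * ((j : ℕ) : ZMod q) ^ (i : ℕ)) - a)) :=
    Finset.sum_congr rfl fun t _ => by ring_nf
  rw [hsum, sum_nwChar_mul, ← map_mul]
  have hq : (q : ℂ) ≠ 0 := Nat.cast_ne_zero.mpr (NeZero.ne q)
  by_cases h : (∑ i : Fin k, cf i * ((j : ℕ) : ZMod q) ^ (i : ℕ)) = a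
  · rw [if_pos (sub_eq_zero.mpr h), if_pos h, inv_mul_cancel₀ hq, C_1]
  · rw [if_neg (fun h' => h (sub_eq_zero.mp h')), if_neg h, mul_zero, C_0]

/-- `LINE_j` at the one-hot encoding of `cf` is the design variable `x_{j, p_cf(j)}`. [cite: KayalSahaSaptharishi2014, §1] -/
theorem aeval_nwLine_graph (cf : Fin k → ZMod q) (e : Fin (k * q) → Bool)
    (he : ∀ i b, e (nwBix q k (i, b)) = fnGraph cf (i, b)) (j : Fin d) :
    aeval (Sum.elim X fun v => if e v then (1 : MvPolynomial (Σ _ : Fin d, ZMod q) ℂ) else 0)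
      (nwLine q d k j) =
      X (⟨j, ∑ i : Fin k, cf i * ((j : ℕ) : ZMod q) ^ (i : ℕ)⟩ : Σ _ : Fin d, ZMod q) := by
  classical
  unfold nwLine
  simp only [map_sum, map_mul, aeval_X, Sum.elim_inl, aeval_nwInd_graph cf e he, mul_ite, mul_one,
    mul_zero]
  rw [Finset.sum_ite_eq]
  simp

/-- **The design polynomial is the Boolean sum of the witness**:
`Σ_{e ∈ {0,1}^{kq}} W(x, e) = NW_{q,d,k}(x)`. [cite: KayalSahaSaptharishi2014, §1] -/
theorem boolSum_nwWitness : boolSum (nwWitness q d k) = nwDesign q d k := by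
  classical
  unfold boolSum nwWitness
  simp only [map_mul]
  -- reindex the Boolean points by one-hot tables
  rw [← Equiv.sum_comp (Equiv.arrowCongr (nwBix q k) (Equiv.refl Bool))]
  have hvalid : ∀ E : Fin k × ZMod q → Bool,
      aeval (Sum.elim X fun v => if (Equiv.arrowCongr (nwBix q k) (Equiv.refl Bool) E) v then
        (1 : MvPolynomial (Σ _ : Fin d, ZMod q) ℂ) else 0) (nwValid q d k) =
      ∏ i : Fin k, ∑ b : ZMod q, (if E (i, b) = true then
        (1 : MvPolynomial (Σ _ : Fin d, ZMod q) ℂ) else 0) *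
          ∏ b' ∈ univ.erase b, (1 - if E (i, b') = true then 1 else 0) := by
    intro E
    unfold nwValid
    simp only [map_prod, map_sum, map_mul, map_sub, map_one, aeval_nwZ, Equiv.arrowCongr_apply,
      Equiv.coe_refl, Function.comp_apply, id_eq, Equiv.symm_apply_apply]
  simp_rw [hvalid]
  rw [sum_rowRecogniser_mul]
  unfold nwDesign
  refine Finset.sum_congr rfl fun cf _ => ?_
  rw [map_prod]
  refine Finset.prod_congr rfl fun j _ => ?_
  refine aeval_nwLine_graph cf _ (fun i b => ?_) j
  simp [Equiv.arrowCongr_apply]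

end Witness

/-! ### Size of the witness -/

section Bounds

variable (q : ℕ) [NeZero q] (d k : ℕ)

/-- `L(1 − e) ≤ 2` (`1 + (−1)·e`). [cite: BurgisserClausenShokrollahi1997, Def. (21.3)] -/
theorem complexity_one_sub_nwZ_le (i : Fin k) (b : ZMod q) :
    complexity (1 - nwZ q d k i b) ≤ 2 := by
  have he : (1 - nwZ q d k i b) = C 1 + C (-1) * nwZ q d k i b := by
    rw [map_neg, map_one, neg_one_mul, sub_eq_add_neg]
  rw [he]
  have h1 := complexity_add_le_holds (C 1 : MvPolynomial (NWVars q d k) ℂ) (C (-1) * nwZ q d k i b)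
  have h2 := complexity_mul_le_holds (C (-1) : MvPolynomial (NWVars q d k) ℂ) (nwZ q d k i b)
  have h4 := complexity_C_holds (σ := NWVars q d k) (1 : ℂ)
  have h5 := complexity_C_holds (σ := NWVars q d k) (-1 : ℂ)
  have h6 : complexity (nwZ q d k i b) = 0 := complexity_X_holds (k := ℂ) _
  omega

/-- `L(1 + e·c) ≤ 2`. [cite: BurgisserClausenShokrollahi1997, Def. (21.3)] -/
theorem complexity_one_add_nwZ_mul_C_le (i : Fin k) (b : ZMod q) (c : ℂ) :
    complexity (1 + nwZ q d k i b * C c) ≤ 2 := by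
  have h1 := complexity_add_le_holds (1 : MvPolynomial (NWVars q d k) ℂ) (nwZ q d k i b * C c)
  have h2 := complexity_mul_le_holds (nwZ q d k i b) (C c : MvPolynomial (NWVars q d k) ℂ)
  have h4 : complexity (1 : MvPolynomial (NWVars q d k) ℂ) = 0 := by
    rw [← C_1]; exact complexity_C_holds _
  have h5 := complexity_C_holds (σ := NWVars q d k) c
  have h6 : complexity (nwZ q d k i b) = 0 := complexity_X_holds (k := ℂ) _
  omega

/-- `L(VALID) ≤ k (q (3q + 1) + q) + k`. [cite: BurgisserClausenShokrollahi1997, Prop. (21.15)] -/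
theorem complexity_nwValid_le :
    complexity (nwValid q d k) ≤ k * (q * (3 * q + 1) + q) + k := by
  classical
  unfold nwValid
  have hrow : ∀ i : Fin k, complexity (∑ b : ZMod q, nwZ q d k i b *
      ∏ b' ∈ univ.erase b, (1 - nwZ q d k i b')) ≤ q * (3 * q + 1) + q := by
    intro i
    have h := complexity_sum_le_of_le (univ : Finset (ZMod q)) (fun b => nwZ q d k i b *
      ∏ b' ∈ univ.erase b, (1 - nwZ q d k i b')) (3 * q + 1) (fun b _ => by
        refine (complexity_mul_le_holds _ _).trans ?_
        have hX : complexity (nwZ q d k i b) = 0 := complexity_X_holds (k := ℂ) _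
        have hP := complexity_prod_le_of_le (univ.erase b) (fun b' => 1 - nwZ q d k i b') 2
          (fun b' _ => complexity_one_sub_nwZ_le q d k i b')
        have hcard : (univ.erase b).card ≤ q :=
          (Finset.card_erase_le).trans (by rw [Finset.card_univ, ZMod.card])
        have : (univ.erase b).card * 2 + (univ.erase b).card ≤ 3 * q := by omega
        omega)
    rwa [Finset.card_univ, ZMod.card] at h
  have h := complexity_prod_le_of_le (univ : Finset (Fin k)) _ _ (fun i _ => hrow i)
  rwa [Finset.card_univ, Fintype.card_fin] at h

/-- `L(CHR_{t,j}) ≤ 3 k q + k`. [cite: BurgisserClausenShokrollahi1997, Prop. (21.15)] -/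
theorem complexity_nwChr_le (t : ZMod q) (j : Fin d) :
    complexity (nwChr q d k t j) ≤ k * (3 * q) + k := by
  classical
  unfold nwChr
  have hrow : ∀ i : Fin k, complexity (∏ b : ZMod q,
      (1 + nwZ q d k i b * C (nwChar q (t * b * ((j : ℕ) : ZMod q) ^ (i : ℕ)) - 1))) ≤ 3 * q := by
    intro i
    have h := complexity_prod_le_of_le (univ : Finset (ZMod q))
      (fun b : ZMod q => (1 + nwZ q d k i b *
        C (nwChar q (t * b * ((j : ℕ) : ZMod q) ^ (i : ℕ)) - 1))) 2
      (fun b _ => complexity_one_add_nwZ_mul_C_le q d k i b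
        (nwChar q (t * b * ((j : ℕ) : ZMod q) ^ (i : ℕ)) - 1))
    rw [Finset.card_univ, ZMod.card] at h
    omega
  have h := complexity_prod_le_of_le (univ : Finset (Fin k)) _ _ (fun i _ => hrow i)
  rwa [Finset.card_univ, Fintype.card_fin] at h

/-- `L(IND_{j,a}) ≤ q (3kq + k + 1) + q + 1`. [cite: BurgisserClausenShokrollahi1997, Prop. (21.15)] -/
theorem complexity_nwInd_le (j : Fin d) (a : ZMod q) :
    complexity (nwInd q d k j a) ≤ q * (k * (3 * q) + k + 1) + q + 1 := by
  classical
  unfold nwInd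
  refine (complexity_mul_le_holds _ _).trans ?_
  have hC := complexity_C_holds (σ := NWVars q d k) ((q : ℂ)⁻¹)
  have hS := complexity_sum_le_of_le (univ : Finset (ZMod q))
    (fun t => C (nwChar q (-(t * a))) * nwChr q d k t j) (k * (3 * q) + k + 1) (fun t _ => by
      refine (complexity_mul_le_holds _ _).trans ?_
      have h1 := complexity_C_holds (σ := NWVars q d k) (nwChar q (-(t * a)))
      have h2 := complexity_nwChr_le q d k t j
      omega)
  rw [Finset.card_univ, ZMod.card] at hS
  omega

/-- `L(LINE_j) ≤ q (q (3kq + k + 1) + q + 2) + q`. [cite: BurgisserClausenShokrollahi1997, Prop. (21.15)] -/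
theorem complexity_nwLine_le (j : Fin d) :
    complexity (nwLine q d k j) ≤ q * (q * (k * (3 * q) + k + 1) + q + 2) + q := by
  classical
  unfold nwLine
  have hS := complexity_sum_le_of_le (univ : Finset (ZMod q))
    (fun a => X (Sum.inl ⟨j, a⟩) * nwInd q d k j a) (q * (k * (3 * q) + k + 1) + q + 2) (fun a _ => by
      refine (complexity_mul_le_holds _ _).trans ?_
      have h1 : complexity (X (Sum.inl ⟨j, a⟩) : MvPolynomial (NWVars q d k) ℂ) = 0 :=
        complexity_X_holds (k := ℂ) _
      have h2 := complexity_nwInd_le q d k j a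
      omega)
  rwa [Finset.card_univ, ZMod.card] at hS

/-- **`L(W) ≤ 17 (q + k + d + 1)^5`**: the witness has polynomial circuit complexity in the
parameters. [cite: KayalSahaSaptharishi2014, §1] -/
theorem complexity_nwWitness_le :
    complexity (nwWitness q d k) ≤ 17 * (q + k + d + 1) ^ 5 := by
  classical
  unfold nwWitness
  refine (complexity_mul_le_holds _ _).trans ?_
  have hV := complexity_nwValid_le q d k
  have hL := complexity_prod_le_of_le (univ : Finset (Fin d)) (fun j => nwLine q d k j) _
    (fun j _ => complexity_nwLine_le q d k j)
  rw [Finset.card_univ, Fintype.card_fin] at hL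
  set N := q + k + d + 1 with hN
  have hq : q ≤ N := by omega
  have hk : k ≤ N := by omega
  have hd : d ≤ N := by omega
  have h1 : 1 ≤ N := by omega
  have hp2 : N ≤ N ^ 2 := by nlinarith
  have hp3 : N ^ 2 ≤ N ^ 3 := Nat.pow_le_pow_right h1 (by norm_num)
  have hp4 : N ^ 3 ≤ N ^ 4 := Nat.pow_le_pow_right h1 (by norm_num)
  have hp5 : N ^ 4 ≤ N ^ 5 := Nat.pow_le_pow_right h1 (by norm_num)
  have hV' : complexity (nwValid q d k) ≤ 6 * N ^ 3 := by
    refine hV.trans ?_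
    calc k * (q * (3 * q + 1) + q) + k ≤ N * (N * (3 * N + 1) + N) + N := by gcongr
      _ = 3 * N ^ 3 + 2 * N ^ 2 + N := by ring
      _ ≤ 6 * N ^ 3 := by omega
  have hL' : complexity (∏ j : Fin d, nwLine q d k j) ≤ 10 * N ^ 5 := by
    refine hL.trans ?_
    calc d * (q * (q * (k * (3 * q) + k + 1) + q + 2) + q) + d
        ≤ N * (N * (N * (N * (3 * N) + N + 1) + N + 2) + N) + N := by gcongr
      _ = 3 * N ^ 5 + N ^ 4 + 2 * N ^ 3 + 3 * N ^ 2 + N := by ring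
      _ ≤ 10 * N ^ 5 := by omega
  have h15 : 1 ≤ N ^ 5 := Nat.one_le_pow _ _ h1
  omega

/-- **`deg W ≤ 2 (q + k + d + 1)^3`**. [cite: KayalSahaSaptharishi2014, §1] -/
theorem totalDegree_nwWitness_le :
    (nwWitness q d k).totalDegree ≤ 2 * (q + k + d + 1) ^ 3 := by
  classical
  have hZ : ∀ i b, (nwZ q d k i b).totalDegree ≤ 1 := fun i b => totalDegree_X_le_one _
  have h1Z : ∀ i b, (1 - nwZ q d k i b).totalDegree ≤ 1 := fun i b =>
    (totalDegree_sub _ _).trans (max_le (by rw [totalDegree_one]; exact Nat.zero_le _) (hZ i b))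
  have hq' : ∀ b : ZMod q, (univ.erase b).card ≤ q := fun b =>
    (Finset.card_erase_le).trans (by rw [Finset.card_univ, ZMod.card])
  -- VALID
  have hrowV : ∀ (i : Fin k) (b : ZMod q),
      (nwZ q d k i b * ∏ b' ∈ univ.erase b, (1 - nwZ q d k i b')).totalDegree ≤ q + 1 := by
    intro i b
    refine (totalDegree_mul _ _).trans ?_
    have hP := totalDegree_prod_le_of_le (univ.erase b) (fun b' => 1 - nwZ q d k i b') 1
      (fun b' _ => h1Z i b')
    have := hZ i b
    have := hq' b
    rw [mul_one] at hP
    omega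
  have hV : (nwValid q d k).totalDegree ≤ k * (q + 1) := by
    unfold nwValid
    have h := totalDegree_prod_le_of_le (univ : Finset (Fin k))
      (fun i => ∑ b : ZMod q, nwZ q d k i b * ∏ b' ∈ univ.erase b, (1 - nwZ q d k i b')) (q + 1)
      (fun i _ => totalDegree_sum_le_of_le _ _ _ fun b _ => hrowV i b)
    rwa [Finset.card_univ, Fintype.card_fin] at h
  -- CHR, IND, LINE
  have hfac : ∀ (i : Fin k) (b : ZMod q) (c : ℂ), (1 + nwZ q d k i b * C c).totalDegree ≤ 1 := by
    intro i b c
    refine (totalDegree_add _ _).trans (max_le (by rw [totalDegree_one]; exact Nat.zero_le _) ?_)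
    refine (totalDegree_mul _ _).trans ?_
    rw [totalDegree_C, add_zero]
    exact hZ i b
  have hChr : ∀ t j, (nwChr q d k t j).totalDegree ≤ k * q := by
    intro t j
    unfold nwChr
    have hin : ∀ i : Fin k, (∏ b : ZMod q, (1 + nwZ q d k i b *
        C (nwChar q (t * b * ((j : ℕ) : ZMod q) ^ (i : ℕ)) - 1))).totalDegree ≤ q := by
      intro i
      have h' := totalDegree_prod_le_of_le (univ : Finset (ZMod q)) (fun b : ZMod q =>
        (1 + nwZ q d k i b * C (nwChar q (t * b * ((j : ℕ) : ZMod q) ^ (i : ℕ)) - 1))) 1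
        (fun b _ => hfac i b _)
      rwa [Finset.card_univ, ZMod.card, mul_one] at h'
    have h := totalDegree_prod_le_of_le (univ : Finset (Fin k)) (fun i : Fin k => ∏ b : ZMod q,
      (1 + nwZ q d k i b * C (nwChar q (t * b * ((j : ℕ) : ZMod q) ^ (i : ℕ)) - 1))) q
      (fun i _ => hin i)
    rwa [Finset.card_univ, Fintype.card_fin] at h
  have hInd : ∀ j a, (nwInd q d k j a).totalDegree ≤ k * q := by
    intro j a
    unfold nwInd
    refine (totalDegree_mul _ _).trans ?_
    rw [totalDegree_C, zero_add]
    refine totalDegree_sum_le_of_le _ _ _ fun t _ => (totalDegree_mul _ _).trans ?_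
    rw [totalDegree_C, zero_add]
    exact hChr t j
  have hLine : ∀ j, (nwLine q d k j).totalDegree ≤ k * q + 1 := by
    intro j
    unfold nwLine
    refine totalDegree_sum_le_of_le _ _ _ fun a _ => (totalDegree_mul _ _).trans ?_
    have h1 : (X (Sum.inl ⟨j, a⟩) : MvPolynomial (NWVars q d k) ℂ).totalDegree ≤ 1 :=
      totalDegree_X_le_one _
    have h2 := hInd j a
    omega
  have hL : (∏ j : Fin d, nwLine q d k j).totalDegree ≤ d * (k * q + 1) := by
    have h := totalDegree_prod_le_of_le (univ : Finset (Fin d)) (fun j => nwLine q d k j) _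
      (fun j _ => hLine j)
    rwa [Finset.card_univ, Fintype.card_fin] at h
  unfold nwWitness
  refine (totalDegree_mul _ _).trans ?_
  set N := q + k + d + 1 with hN
  have hq : q ≤ N := by omega
  have hk : k ≤ N := by omega
  have hd : d ≤ N := by omega
  have h1 : 1 ≤ N := by omega
  have hp3 : N ^ 2 ≤ N ^ 3 := Nat.pow_le_pow_right h1 (by norm_num)
  have hp2 : N ≤ N ^ 2 := by nlinarith
  have hV' : (nwValid q d k).totalDegree ≤ N ^ 2 + N := by
    refine hV.trans ?_
    calc k * (q + 1) ≤ N * (N + 1) := by gcongr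
      _ = N ^ 2 + N := by ring
  have hL' : (∏ j : Fin d, nwLine q d k j).totalDegree ≤ N ^ 3 + N := by
    refine hL.trans ?_
    calc d * (k * q + 1) ≤ N * (N * N + 1) := by gcongr
      _ = N ^ 3 + N := by ring
  have h2N : 2 ≤ N := by have := NeZero.pos q; omega
  have hcube : N ^ 2 + 2 * N ≤ N ^ 3 := by nlinarith
  omega

/-- The design polynomial has degree `≤ d`. [cite: KayalSahaSaptharishi2014, §1] -/
theorem totalDegree_nwDesign_le : (nwDesign q d k).totalDegree ≤ d := by
  classical
  unfold nwDesign
  refine totalDegree_sum_le_of_le _ _ _ fun cf _ => ?_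
  have h := totalDegree_prod_le_of_le (univ : Finset (Fin d))
    (fun j : Fin d => (X (⟨j, ∑ i : Fin k, cf i * ((j : ℕ) : ZMod q) ^ (i : ℕ)⟩ : Σ _ : Fin d, ZMod q) :
      MvPolynomial (Σ _ : Fin d, ZMod q) ℂ)) 1
    (fun j _ => totalDegree_X_le_one _)
  rwa [Finset.card_univ, Fintype.card_fin, mul_one] at h

end Bounds

end Literature.Computability.AlgebraicComplexity
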